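import Mathlib
import HarnessLib
import HarnessLib.Audit
import Summits.ValiantsHypothesis.Statement
import Summits.ValiantsHypothesis.ValiantsHypothesis.Theorems.TauConstTauBurgisser
import HarnessLib.Audit.Status.Attr

/-!
Route: SqrtTowers

CLOSED (superseded) 2026-08-15T16:30:27Z by planner-rrepair-ValiantsHypothesis-SqrtTowers-d43a35f2-g2-0 — reason: superseded:route-ValiantsHypothesis-TauConst — superseded by route-ValiantsHypothesis-TauConst — note: route-repair (cone guardrail, gen 2). CONE: payload listed 0 of "2 unproved cone facts" and run/shared/views/cone/ValiantsHypothesis.{md,json} do not exist; the gate's own h21_route_deps evaluation (native preview, 39 consts) shows NO unproved zero-binder fact in the decl cone (every cite_only prop_. The file is kept as the record of this route; refuted decls are indexed as negative knowledge (`ledger negatives`).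

# Route SqrtTowers — τ for square-root towers — integer roots of nested quadratics x ↦ x²+cᵢ as
integral points of non-autonomous backward orbits; Diophantine-uniformity rung of the τ-line

X = TauThesis, the target of route TauConst (same signature, shared decl): (i) the Shub–Smale
τ-conjecture — distinct
integer roots of a nonzero f ∈ ℤ[T] are ≤ (τ(f)+2)^c — AND (ii) constant elimination for the
permanent (VP ℂ = VNP ℂ ⇒
τ(per_n) p-bounded). This route is an ALTERNATIVE DECOMPOSITION of conjunct (i) BY WORD CLASSES,
opened at its first rung
(card tau-square-root-towers): SQUARE-ROOT TOWERS u₀ = x, u_{i+1} = u_i² + c_i, encoded by c : List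
ℤ with value
`c.foldl (fun u a => u ^ 2 + a) x`; the integer roots of u_d are the integral points of the backward
orbit of 0 under a
NON-AUTONOMOUS quadratic dynamical system. The ranked cruxes are the three rung statements:
TowerUniform (≤ (d+2)^k roots
whatever the heights of the c_i — Diophantine uniformity, the card's engine), TowerTau (the
τ-conjecture on the class) and
the finite frontier NoFullDepthFive (no tower of depth 5 has 2⁵ integer roots). Conjunct (ii) is
inherited unchanged.
Lean: `(∃ c : ℕ, ∀ f : Polynomial ℤ, f ≠ 0 → f.roots.toFinset.card ≤
(Literature.Computability.AlgebraicComplexity.constantFreeComplexity ((MvPolynomial.uniqueAlgEquiv ℤ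
(Fin 1)).symm f) + 2) ^ c) ∧ (Literature.Computability.AlgebraicComplexity.VP ℂ =
Literature.Computability.AlgebraicComplexity.VNP ℂ →
Literature.Computability.AlgebraicComplexity.IsPBounded (fun n =>
Literature.Computability.AlgebraicComplexity.constantFreeComplexity
(Literature.Computability.AlgebraicComplexity.perPoly (Fin n) ℤ)))`

## Assembly
Pure logic, sorry-free in Sketch.lean: the three rungs are carried as hypotheses (they are the
route's information, not
load-bearing — a word-class case of (i) cannot feed Bürgisser's reduction, which produces an
arbitrary circuit for a
multiple of the Pochhammer–Wilkinson polynomial); TauThesis gives (i) and (ii); TauBurgisser turns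
(i) into
¬IsPBounded τ(per_n); if VP ℂ = VNP ℂ then (ii) gives IsPBounded τ(per_n) — contradiction, hence VP
ℂ ≠ VNP ℂ =
ValiantsHypothesis.

Rationale: WHY THIS LINE. The barrier TauRealZeros says a proof of (i) must USE INTEGRALITY; the smallest word
class in which that bites is the class
of square-root towers: taking every c_i = −2 gives the Dickson polynomial D_{2^d}(x) =
2·T_{2^d}(x/2) (τ ≤ 2d+2, 2^d real
zeros in (−2,2), no integer zero), the conjugate of the catalogued Chebyshev witness, while c =
(−65, −1696, −1440²)
already has the maximal 2³ integer roots ±3,±7,±9,±11 and (found in this unit) depth 4 is also full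
(16 roots, § Numbers).
On this class the root set is a backward preimage tree, growth from one level to the next happens
only through
representations −2c_i = a² + b² whose half-differences are roots one level up
(BranchingByTwoSquares), and "many roots"
becomes "an integral point high on a tower of curves of exploding genus" — the setting of arithmetic
dynamics, where for
the AUTONOMOUS family x² + c rational preimages are bounded UNIFORMLY IN c via preimage curves of
genus (N−3)2^{N−2}+1 and
Faltings/Vojta (FaberEtAl2009 = arXiv:0805.0441 Thms 1.2, 3.2; FaberHutzStoll2011; Sano
arXiv:2510.14397 for x^k + c),
and where uniformity across a family is the Caporaso–Harris–Mazur fibred-power mechanism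
(CaporasoHarrisMazur1997, under
Bombieri–Lang). Imported: arithmetic dynamics (preimage curves, uniform boundedness), Diophantine
geometry (integral points,
CHM uniformity), elementary sums of two squares / Gaussian integers; what prior routes do not do:
TauConst files (i) whole
with "Diophantine input expected" and no engine (ShubSmale1995, Burgisser2009, Koiran2011); this
route gives (i) a typed
laboratory whose three rungs are provable or refutable with existing tools and whose failure modes
are computable.

RANKED CRUXES. #0 TauThesis (target) — X = (i) τ-conjecture ∧ (ii) constant elimination for per_n,
verbatim the target of route TauConst (shared item). (why it might fail: (i) dies if some multiple
of ∏_{i≤n}(X−i) has τ = (log n)^O(1) (open); (ii) is the constant gap ("VP_C ≠ VNP_C ⇒ VP⁰ ≠ VNP⁰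
trivial, converse unclear", Bürgisser 2026); the rungs below bear on (i) for one word class only.)
[ShubSmale1995, Burgisser2009, arXiv:2406.06217, arXiv:2606.25121]
#2 TowerUniform (crux) — Diophantine uniformity for square-root towers (card crux, made
unconditional and height-free): there is k such that for every c : List ℤ of length d, the program
u₀ = x, u_{i+1} = u_i² + c_i has at most (d+2)^k distinct integer roots — independently of the
heights of the c_i. [difficulty: open-problem] (why it might fail: Full towers (2^d roots) exist at
depth 3 AND 4 (16 roots: c₀ = −67405, roots ±{11,77,101,131,343,353,359,367}, found here); full
depth-d towers form a (d−1)-dimensional family and only M(a+b) ≤ M(a)M(b) is known — one family with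
(1+ε)^d roots kills it.) [CaporasoHarrisMazur1997, FaberEtAl2009, FaberHutzStoll2011,
arXiv:2510.14397, ShubSmale1995]
#3 TowerTau (crux) — the τ-conjecture on the square-root-tower word class: #integer roots of u_d ≤
(d + Σ_i τ(c_i) + 2)^k, τ(c_i) = constant-free complexity of the integer c_i (as the constant of
MvPolynomial (Fin 1) ℤ, = tauInt c_i); implied by TauConjecture since τ(u_d) ≤ 3d + Σ τ(c_i), and by
TowerUniform. [deps: TowerUniform] [difficulty: open-problem] (why it might fail: It is (i) verbatim
on this class: r₂(2|c₀|) alone reaches exp(c·log|c₀|/log log|c₀|) ≫ poly(log|c₀|) for c₀ a product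
of primes ≡ 1 (4), so the bound must come from the interplay of levels, for which no height, sieve
or p-adic tool is known; cheap huge constants (τ(2^(2^n)) = n+O(1)) are untouched.) [ShubSmale1995,
Burgisser2009, arXiv:1004.4960, arXiv:math/0201154, arXiv:1309.0486]
#4 NoFullDepthFive (crux) — the finite frontier: no square-root tower of depth 5 is full, i.e. every
c : List ℤ of length 5 has at most 31 distinct integer roots (then no tower of any depth ≥ 5 is
full, since the top five levels of a full tower are a full depth-5 tower, and M(d) ≤ 31^⌈d/5⌉).
[difficulty: M] (why it might fail: Full depth-4 towers are plentiful (134 with all roots ≤ 2·10⁴, ≥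
4 primitive classes, search in this unit); depth 5 is one more coincidence (8 representations N₀ =
a²+b² whose half-differences form a full depth-4 set) in a 4-dimensional family — a full depth-5
tower may just have roots > 2·10⁴.) [FaberHutzStoll2011, doi:10.2140/involve.2011.4.343,
FaberEtAl2009]
#9 TauBurgisser (support) — Bürgisser's transfer (theorem in print, shared with TauConst): the
τ-conjecture implies τ(per_n) is not p-bounded. [difficulty: L] [Burgisser2009, arXiv:2406.06217]
#9 BranchingByTwoSquares (support) — the tree formalism (card R0/R1, corrected): if S are integer
roots of the tower c₀ :: c and T contains every integer root of the upper tower c, then |S| ≤ |T| +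
1 + 2·#{v ∈ T : v > 0, and both v and −v are hit by x ↦ x² + c₀ from S} — growth beyond +1 per level
happens only through doubly split pairs ±v, each giving −2c₀ = x² + y² with (x² − y²)/2 = v a root
one level up (elementary counting + symmetry of the upper root set). [difficulty: provable-now]
[FaberHutzStoll2011]
#9 DepthFourSharp (support) — depth 4 is full: some tower of length 4 has 16 distinct integer roots
— witness c = [−67405, −3525798096, −533470702551552000, −220156343572527011594632754626560000], S =
±{11, 77, 101, 131, 343, 353, 359, 367} (so the threshold 5 in NoFullDepthFive is the true frontier,
and the inline encoding is pinned by a decidable instance). [difficulty: provable-now]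
[FaberHutzStoll2011]

TWO-LAYER PLAN. Foreseen glued splits (filed only when a rung closes or stalls with a census):
TowerTau ⇐ TowerHeightBound (bound
(d + Σ log₂(|c_i|+2))^k, the incompressible-constants shadow) → CheapConstantsGlue (towers whose
huge c_i have small τ
reduce to bounded height) → TowerTau; TowerUniform ⇐ EntropyDrop (NoFullDepthFive-type: M(d₀) <
2^{d₀}) → LevelDensity
(local purity: at a doubly split level the upper half-set is constant mod 3-classes {0} | {±1},
2-adically graded, …,
bounding doubly split pairs per level by o(|V_{i+1}|)) → TowerUniform; NoFullDepthFive ⇐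
LocalObstruction (no full
depth-5 tower modulo some fixed 2^a·3^b·5·…) or GaussianDescent (primitive full towers have odd
roots and e/4 descends
to a primitive full tower one level down) → NoFullDepthFive.

KILL CRITERIA. ¬TowerTau (a tower family with super-polynomially many integer roots measured against
d + Στ(c_i)) refutes the
τ-conjecture itself: close `refuted:TowerTau`, the witness goes to the negatives index and breaks
TauConst (i) too.
¬TowerUniform by towers whose constants are incompressible (many roots only at heights ≫ 2^poly(d))
kills the
UNIFORMITY thesis but not τ: pivot in tenure — restate rank 2 as the height form (TowerHeightBound)
with technique class
heights/sieve, or close `refuted:TowerUniform` if no such restatement is typed within the grace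
window. ¬NoFullDepthFive
(a 32-root depth-5 tower) is informative, not fatal: drop it with the witness recorded and make
EntropyDrop at the first
depth the data allows the new rank-4 item (a different statement, not a rewording); a CONSTRUCTION
of full towers at
every depth with c_i of τ = poly(d) is ¬TowerTau (fatal, above). TauConjecture proved elsewhere ⇒
rungs become support,
route superseded by TauConst; TauConstElim refuted ⇒ assembly dead for both routes (close
superseded/refuted with TauConst).

NOT DECOMPOSED YET. Everything below the rungs: the height form TowerHeightBound and the
cheap-constants glue (children of TowerTau); local
density / 2-adic descent lemmas (children of TowerUniform, NoFullDepthFive); the CHM fibred-power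
argument on the tower
varieties {(x₁,…,x_m, c) : u_d(x_j) = 0} and any Bombieri–Lang-CONDITIONAL uniformity item (filed as
`(h : BombieriLang) →
TowerUniform` only if rung data keep uniformity plausible — Bombieri–Lang is not a tree fact and
would be the first crux of
such a sub-line); the next rungs of the ladder (general quadratics a_i x² + b_i x + c_i, which
contain T_{2^k} itself;
bounded-degree compositions; DAG towers = general SLPs); conjunct (ii) entirely (TauConst's
TauConstElim, rank 2 there).

CHEAPEST FALSIFIER. Exhaustive search, done here in plain Python (seconds–minutes, /tmp-free
description in NOTES.md): enumerate N₀ = −2c₀ =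
a² + b² (a ≡ b mod 2) and test whether 4 resp. 8 half-differences (a²−b²)/2 form a full depth-3
resp. depth-4 half-set.
Result: full depth-4 towers (16 roots) EXIST — 27 with N₀ ≤ 2·10⁷, 134 among two-squares-rich N₀ ≤
4·10⁸; NO full
depth-5 tower (32 roots) with N₀ ≤ 4·10⁸ (all roots ≤ 2·10⁴). Next cheapest (kit, minutes): push
depth 5 to N₀ ≤ 10¹²
via the Gaussian-integer parametrisation (roots ±Re/Im of z with |z|² = N₀, half-differences
Re(z²)/2) and the 2-adic
descent, and measure max #roots / 2^d for random-greedy towers of depth 8–16 at small height: a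
depth-5 full tower
refutes NoFullDepthFive; root counts growing like (1+ε)^d at heights 2^{O(d)} make TowerUniform
suspect-false.

NUMBERS. M(d) := max number of distinct integer roots of a depth-d square-root tower (≤ 2^d =
degree): M(1) = 2, M(2) = 4,
M(3) = 8 (c = (−65, −1696, −1440²): ±3, ±7, ±9, ±11; card), M(4) = 16 (this unit: c = (−67405,
−3525798096,
−533470702551552000, −220156343572527011594632754626560000): ±{11,77,101,131,343,353,359,367};
further primitive N₀ = −2c₀ ∈
{269620, 1200890, 11830130}), M(5) unknown: no 32-root tower with N₀ ≤ 4·10⁸. Sub-multiplicativity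
M(a+b) ≤ M(a)·M(b)
(the fibre of u_a over each root of the upper tower is the root set of a depth-a tower with shifted
last constant).
Structure of full towers: roots ±a_j, ±b_j with a_j² + b_j² = N₀ for all j, level-1 values e_j =
(a_j² − b_j²)/2 again a
full configuration (16821² + 12561² = 15369² + 14301² under the depth-4 witness, after the forced
factor 4). Barrier
witness inside the class: c_i = −2 ∀ i gives D_{2^d} = 2T_{2^d}(x/2): τ ≤ 2d+2, 2^d real roots, 0
integer roots.
Autonomous analogue (FaberEtAl2009 Thm 1.2, p.3; Thm 3.2, p.7): for x² + c over a number field and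
all but finitely many a,
bounded-degree preimages of a (all levels) are bounded independently of c, via preimage curves of
genus (N−3)·2^{N−2} + 1 and Vojta; their
non-uniform family (x−b)² + b, b = a − 2^(2^N), is exactly a cheap-huge-constant tower. Items at
open: 8 (3 cruxes).

DEFINITION REQUESTS. None. The tower is inlined as `c.foldl (fun u a => u ^ 2 + a) x` over `c : List
ℤ` (elaborated, and checked by `decide`
on the depth-3 and depth-4 witnesses in Sketch.lean); τ of an integer is `constantFreeComplexity
(MvPolynomial.C a :
MvPolynomial (Fin 1) ℤ)` (= `Literature.Computability.AlgebraicComplexity.tauInt a` by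
`tauInt_eq_constantFreeComplexity_C`). A named `towerEval` / root-set API may be requested by the
first prover as a
`--supports` helper; no Literature notion is missing. Bib keys added this session:
CaporasoHarrisMazur1997, FaberEtAl2009,
FaberHutzStoll2011.

Novelty: Searches (2026-08-15): card audit (refuter novelty-audit-4: zbMATH, FHIJMTZ full text, 47 cards,
frontier) inherited;
this unit: `lit search --source zbmath` ×9 ("Shub Smale tau conjecture integer roots" 2 hits:
arXiv:1706.00080,
arXiv:1309.0486; "additive complexity number of integer roots" → Rojas arXiv:math/0201154; "iterated
preimages quadratic
polynomial rational" 4 hits incl. Sano arXiv:2510.14397, arXiv:1909.00039; "backward orbits integral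
points arithmetic
dynamics" → arXiv:2511.13443; "compositions of quadratic polynomials rational roots",
"non-autonomous quadratic polynomials
Galois iterates", "polynomial decomposition totally split rational roots", "semigroup dynamics …
rational preimages
uniform", "dynamical sequences … Hindes": 0 relevant); `lit search --source crossref`
(Faber–Hutz–Stoll
doi:10.1142/s1793042111004162, Hutz–Hyde–Krause doi:10.2140/involve.2011.4.343, Faber CRAS 2010
doi:10.1016/j.crma.2010.02.010); `lit frontier ValiantsHypothesis --since 2022` (30 rows; only
arXiv:2601.00387 is
τ-related, exponential sums, not Diophantine); `lit read arxiv:0805.0441` pp.3,7 (Thms 1.2, 1.3, 3.2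
read); `lit galaxy
search … --star all|pdf|panama` ×3 (service saturated, 0 rows); `lit search --hybrid` local (8 docs,
none relevant).
Nearest prior art found: FaberEtAl2009 (arXiv:0805.0441) + FaberHutzStoll2011 + Sano
arXiv:2510.14397 — preimage
trees/curves of x² + c (resp. x^k + c), genus growth, Faltings/Vojta ⇒ bounds uniform in c,
AUTONOMOUS and over ℚ;
CaporasoHa  [refs: 10.1142/s1793042111004162, 10.2140/involve.2011.4.343, 10.1016/j.crma.2010.02.010, 1706.00080, 1309.0486, math/0201154, 2510.14397, 1909.00039, 2511.13443, 2601.00387, 0805.0441, 1004.4960, doi:10.1142/s1793042111004162, doi:10.2140/involve.2011.4.343, doi:10.1016/j.crma.2010.02.010, arxiv:0805.0441, FaberEtAl2009, FaberHutzStoll2011, CaporasoHarrisMazur1997, ShubSmale1995, Burgisser2009, Koiran20]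

Barriers (technique_class: diophantine-uniformity, arithmetic-dynamics): - technique_class: diophantine-uniformity, arithmetic-dynamics
- Literature.Barriers.ValiantsHypothesis.TauRealZeros: APPLIES to the class (it contains D_{2^d} =
2T_{2^d}(x/2): c_i = −2, τ ≤ 2d+2, 2^d real zeros, 0 integer zeros), so no real-zero count can prove
TowerUniform/TowerTau; evaded because every rung uses integrality — two-squares representations of
−2c_i, local (mod p, 2-adic) purity of level sets, integral points on preimage curves — none of
which sees real zeros.
- Literature.Barriers.ValiantsHypothesis.AlgebraicNaturalProofs: does not meet the technique class —
the line bounds ℤ-points of specific programs and reaches VNP ⊄ VP⁰-type conclusions through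
Bürgisser's counting-hierarchy transfer, not through a constructible property of coefficient vectors
of VP; nothing to evade.
- Uncatalogued, inherited: the constant barrier (TauThesis (ii) = TauConst.TauConstElim: const-free
completeness of per only up to 2^{p(n)}, elimination of complex constants open) — not evaded; this
route adds nothing to (ii) and says so.
- Uncatalogued, specific to this line: uniformity constants à la CHM grow with the genus, which
doubles per level — TowerUniform needs them polylogarithmic along towers; the bet is that
integrality (not rationality) and the rigid two-squares recursion supply that, and
NoFullDepthFive/EntropyDrop is where the bet is first tested.
- Negatives index: empty for ValiantsHypothesis at filing (ledger negatives, 2026-08-15).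

Novelty grade: variant — REGRADE s4 (supersedes my 13:59Z new-combination, given while lit search was rc75): the word class is PUBLISHED with the same motivation. Square-root towers with 2^d integer roots = Crandall's squaring ladders (Cr96 Prob 3.1.13; Crandall–Pomerance Research Problem 6.16, READ: asks for k>3, reports S (refuter refuter-rreview-route-AtomisticToContinu-a8207b56-0, 2026-08-15T14:29:22Z; prior: doi:10.4086/cjtcs.2013.002 (Borchert-McKenzie-Reinhardt CJTCS 2013; conf. MFCS 2009 doi:10.1007/978-3-642-03816-7_15) READ pp.1-17, CrandallPomerance2005 Prime Numbers, Research Problem 6.16 (squaring ladders; Symes k=4) READ, doi:10.1080/10586458.2000.10504413 (Dilcher 2000, n=3 characterised; paywalled, want filed), doi:10.1080/10586458.2008.10128879 (Bremner 2008, two infinite families n=4; pay)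

History (route lifecycle, newest last):
- 2026-08-15T16:30:27Z · CLOSED superseded — superseded:route-ValiantsHypothesis-TauConst (planner-rrepair-ValiantsHypothesis-SqrtTowers-d43a35f2-g2-0)

sub-problem: ValiantsHypothesis · status: closed(superseded) · opened planner-plancard-ValiantsHypothesis-ValiantsH-7db26aac-0 2026-08-15T11:35:50Z · rev 1 · ledger route-ValiantsHypothesis-SqrtTowers
GENERATED by the gate from the ledger (D-0016/17). Provers cite these decls: `theorem foo : Summit.ValiantsHypothesis.ValiantsHypothesis.Theses.SqrtTowers.<Decl> := …` in Summits/ValiantsHypothesis/ValiantsHypothesis/Theorems/<Name>.lean.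
-/

namespace Summit.ValiantsHypothesis.ValiantsHypothesis.Theses.SqrtTowers

open scoped BigOperators Topology Manifold Classical MeasureTheory ProbabilityTheory Matrix InnerProductSpace ComplexConjugate ContinuousMap
open Filter Set Function TopologicalSpace MeasureTheory

attribute [summit_statement] _root_.ValiantsHypothesis

open Literature.PNP

/-- item stmt-ValiantsHypothesis-0333 · target · rank 0 · open · by planner
why it might fail: (i) dies if some multiple of ∏_{i≤n}(X−i) has τ = (log n)^O(1) (open); (ii) is the constant gap ("VP_C ≠ VNP_C ⇒ VP⁰ ≠ VNP⁰ trivial, converse unclear", Bürgisser 2026); the rungs below bear on (i) for one word class only.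
sources: ShubSmale1995, Burgisser2009, arXiv:2406.06217, arXiv:2606.25121
Thesis of route TauConst: (i) Shub–Smale τ-conjecture [ShubSmale1995]: distinct integer roots of
nonzero f ∈ ℤ[T] ≤ (τ(f)+2)^c with τ =
Literature.Computability.AlgebraicComplexity.constantFreeComplexity of f viewed in MvPolynomial (Fin
1) ℤ; (ii) VP ℂ = VNP ℂ ⇒ τ(per_n over ℤ) p-bounded. (i) ⇒ per ∉ VP⁰ [Burgisser2009]; (ii) closes
the gap VP⁰ vs VP_ℂ. -/
@[route_item "route-ValiantsHypothesis-SqrtTowers", crux]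
def TauThesis : Prop :=
  (∃ c : ℕ, ∀ f : Polynomial ℤ, f ≠ 0 → f.roots.toFinset.card ≤ (Literature.Computability.AlgebraicComplexity.constantFreeComplexity ((MvPolynomial.uniqueAlgEquiv ℤ (Fin 1)).symm f) + 2) ^ c) ∧ (Literature.Computability.AlgebraicComplexity.VP ℂ = Literature.Computability.AlgebraicComplexity.VNP ℂ → Literature.Computability.AlgebraicComplexity.IsPBounded (fun n => Literature.Computability.AlgebraicComplexity.constantFreeComplexity (Literature.Computability.AlgebraicComplexity.perPoly (Fin n) ℤ)))

/-- item stmt-ValiantsHypothesis-4939 · crux · rank 2 · closed · moot by None · by planner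
why it might fail: Full towers (2^d roots) exist at depth 3 AND 4 (16 roots: c₀ = −67405, roots ±{11,77,101,131,343,353,359,367}, found here); full depth-d towers form a (d−1)-dimensional family and only M(a+b) ≤ M(a)M(b) is known — one family with (1+ε)^d roots kills it.
sources: CaporasoHarrisMazur1997, FaberEtAl2009, FaberHutzStoll2011, arXiv:2510.14397, ShubSmale1995
[crux] Diophantine uniformity for square-root towers (card crux, made unconditional and
height-free): there is k such that for every c : List ℤ of length d, the program u₀ = x, u_{i+1} =
u_i² + c_i has at most (d+2)^k distinct integer roots — independently of the heights of the c_i.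
[difficulty: open-problem] -/
@[route_item "route-ValiantsHypothesis-SqrtTowers", crux]
def TowerUniform : Prop :=
  ∃ k : ℕ, ∀ (c : List ℤ) (S : Finset ℤ), (∀ x ∈ S, c.foldl (fun u a => u ^ 2 + a) x = 0) → S.card ≤ (c.length + 2) ^ k

/-- item stmt-ValiantsHypothesis-4940 · crux · rank 3 · closed · moot by None · by planner
why it might fail: It is (i) verbatim on this class: r₂(2|c₀|) alone reaches exp(c·log|c₀|/log log|c₀|) ≫ poly(log|c₀|) for c₀ a product of primes ≡ 1 (4), so the bound must come from the interplay of levels, for which no height, sieve or p-adic tool is known; cheap huge constants (τ(2^(2^n)) = n+O(1)) are untouched.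
sources: ShubSmale1995, Burgisser2009, arXiv:1004.4960, arXiv:math/0201154, arXiv:1309.0486
[crux] the τ-conjecture on the square-root-tower word class: #integer roots of u_d ≤ (d + Σ_i τ(c_i)
+ 2)^k, τ(c_i) = constant-free complexity of the integer c_i (as the constant of MvPolynomial (Fin
1) ℤ, = tauInt c_i); implied by TauConjecture since τ(u_d) ≤ 3d + Σ τ(c_i), and by TowerUniform.
[deps: TowerUniform] [difficulty: open-problem] -/
@[route_item "route-ValiantsHypothesis-SqrtTowers", crux]
def TowerTau : Prop :=
  ∃ k : ℕ, ∀ (c : List ℤ) (S : Finset ℤ), (∀ x ∈ S, c.foldl (fun u a => u ^ 2 + a) x = 0) → S.card ≤ (c.length + (c.map fun a => Literature.Computability.AlgebraicComplexity.constantFreeComplexity (MvPolynomial.C a : MvPolynomial (Fin 1) ℤ)).sum + 2) ^ k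

/-- item stmt-ValiantsHypothesis-4941 · crux · rank 4 · closed · moot by None · by planner
why it might fail: Full depth-4 towers are plentiful (134 with all roots ≤ 2·10⁴, ≥ 4 primitive classes, search in this unit); depth 5 is one more coincidence (8 representations N₀ = a²+b² whose half-differences form a full depth-4 set) in a 4-dimensional family — a full depth-5 tower may just have roots > 2·10⁴.
sources: FaberHutzStoll2011, doi:10.2140/involve.2011.4.343, FaberEtAl2009
[crux] the finite frontier: no square-root tower of depth 5 is full, i.e. every c : List ℤ of length
5 has at most 31 distinct integer roots (then no tower of any depth ≥ 5 is full, since the top five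
levels of a full tower are a full depth-5 tower, and M(d) ≤ 31^⌈d/5⌉). [difficulty: M] -/
@[route_item "route-ValiantsHypothesis-SqrtTowers", crux]
def NoFullDepthFive : Prop :=
  ∀ (c : List ℤ) (S : Finset ℤ), c.length = 5 → (∀ x ∈ S, c.foldl (fun u a => u ^ 2 + a) x = 0) → S.card ≤ 31

/-- item stmt-ValiantsHypothesis-0337 · support · rank 9 · closed · proved by Summit.ValiantsHypothesis.ValiantsHypothesis.Theorems.TauConst.tauBurgisser_proof (prover) · by planner
sources: Burgisser2009, arXiv:2406.06217
Theorem in print [Burgisser2009 Thm 1.1-1.2 (STACS 2007)]: under the τ-conjecture the permanent has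
no polynomial-size constant-free arithmetic circuits (via counting integer roots of
Pochhammer–Wilkinson polynomials ∏(T-i) computed from factorial-like VNP⁰ families and Valiant
completeness in the constant-free setting). Expected to become a Literature cite fact; hypothesis of
tau_assembly. Grounder: check that constantFreeComplexity (weighted ±1 sums, fan-in 2) matches
Bürgisser's τ up to O(1). -/
@[route_item "route-ValiantsHypothesis-SqrtTowers", crux]
def TauBurgisser : Prop :=
  (∃ c : ℕ, ∀ f : Polynomial ℤ, f ≠ 0 → f.roots.toFinset.card ≤ (Literature.Computability.AlgebraicComplexity.constantFreeComplexity ((MvPolynomial.uniqueAlgEquiv ℤ (Fin 1)).symm f) + 2) ^ c) → ¬ Literature.Computability.AlgebraicComplexity.IsPBounded (fun n => Literature.Computability.AlgebraicComplexity.constantFreeComplexity (Literature.Computability.AlgebraicComplexity.perPoly (Fin n) ℤ))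

/-- `TauBurgisser` holds: proved by `Summit.ValiantsHypothesis.ValiantsHypothesis.Theorems.TauConst.tauBurgisser_proof`. -/
theorem TauBurgisser_holds : TauBurgisser := _root_.Summit.ValiantsHypothesis.ValiantsHypothesis.Theorems.TauConst.tauBurgisser_proof

/-- item stmt-ValiantsHypothesis-4942 · support · rank 9 · closed · moot by None · by planner
sources: FaberHutzStoll2011
[support] the tree formalism (card R0/R1, corrected): if S are integer roots of the tower c₀ :: c
and T contains every integer root of the upper tower c, then |S| ≤ |T| + 1 + 2·#{v ∈ T : v > 0, and
both v and −v are hit by x ↦ x² + c₀ from S} — growth beyond +1 per level happens only through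
doubly split pairs ±v, each giving −2c₀ = x² + y² with (x² − y²)/2 = v a root one level up
(elementary counting + symmetry of the upper root set). [difficulty: provable-now] -/
@[route_item "route-ValiantsHypothesis-SqrtTowers", crux]
def BranchingByTwoSquares : Prop :=
  ∀ (c₀ : ℤ) (c : List ℤ) (S T : Finset ℤ), (∀ x ∈ S, (c₀ :: c).foldl (fun u a => u ^ 2 + a) x = 0) → (∀ y : ℤ, c.foldl (fun u a => u ^ 2 + a) y = 0 → y ∈ T) → S.card ≤ T.card + 1 + 2 * (T.filter fun v => 0 < v ∧ (∃ x ∈ S, x ^ 2 + c₀ = v) ∧ ∃ x ∈ S, x ^ 2 + c₀ = -v).card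

/-- item stmt-ValiantsHypothesis-4943 · support · rank 9 · closed · moot by None · by planner
sources: FaberHutzStoll2011
[support] depth 4 is full: some tower of length 4 has 16 distinct integer roots — witness c =
[−67405, −3525798096, −533470702551552000, −220156343572527011594632754626560000], S = ±{11, 77,
101, 131, 343, 353, 359, 367} (so the threshold 5 in NoFullDepthFive is the true frontier, and the
inline encoding is pinned by a decidable instance). [difficulty: provable-now] -/
@[route_item "route-ValiantsHypothesis-SqrtTowers", crux]
def DepthFourSharp : Prop :=
  ∃ (c : List ℤ) (S : Finset ℤ), c.length = 4 ∧ S.card = 16 ∧ ∀ x ∈ S, c.foldl (fun u a => u ^ 2 + a) x = 0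

/-- item stmt-ValiantsHypothesis-4944 · assembly · rank 1 · closed · moot by None · by planner
sources: Burgisser2009, ShubSmale1995
[assembly] TowerUniform → TowerTau → NoFullDepthFive → TauThesis → TauBurgisser →
ValiantsHypothesis. -/
@[route_item "route-ValiantsHypothesis-SqrtTowers", crux]
def Assembly : Prop :=
  TowerUniform → TowerTau → NoFullDepthFive → TauThesis → TauBurgisser → ValiantsHypothesis

/-! D-0027 §2.1 — DECIDING THEOREM (planner-authored via `route open/edit --closes-file`; by operator:999:377415 2026-08-15T14:41:35Z) — ARCHIVED: route closed (superseded) 2026-08-15T16:30:27Z; kept so importers keep building: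
its hypotheses are this route's items and its conclusion the sub-problem Statement (glue_lint), and it elaborates with this file. -/

@[closes "route-ValiantsHypothesis-SqrtTowers"] theorem closes : TauThesis → TowerUniform → TowerTau → NoFullDepthFive → TauBurgisser → BranchingByTwoSquares → DepthFourSharp → Assembly → _root_.ValiantsHypothesis := fun h_TauThesis h_TowerUniform h_TowerTau h_NoFullDepthFive h_TauBurgisser h_BranchingByTwoSquares h_DepthFourSharp h_Assembly => h_Assembly h_TowerUniform h_TowerTau h_NoFullDepthFive h_TauThesis h_TauBurgisser

end Summit.ValiantsHypothesis.ValiantsHypothesis.Theses.SqrtTowers
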